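import Summits.BirchSwinnertonDyer.BirchSwinnertonDyer.Theorems.SchneiderFreeAdditiveX3BadPrimeCharImprimitiveShift
import Summits.BirchSwinnertonDyer.BirchSwinnertonDyer.Theorems.SchneiderFreeAdditiveX3AnomalousTwistIndexInputs
import Summits.BirchSwinnertonDyer.BirchSwinnertonDyer.Theorems.EisensteinPrimesIndexInputsShellOfSurC
import Summits.BirchSwinnertonDyer.BirchSwinnertonDyer.Theorems.EisensteinPrimesIndexInputsH2OfTateTC
import Summits.BirchSwinnertonDyer.BirchSwinnertonDyer.Theorems.EisensteinPrimesAcTwistDeformationLocSurjOfSurC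
import Summits.BirchSwinnertonDyer.BirchSwinnertonDyer.Theorems.EisensteinPrimesSurLambdaCaseCTCOfPoitouTateAt
import Summits.BirchSwinnertonDyer.BirchSwinnertonDyer.Theorems.SchneiderFreeAdditiveX3GordTwoBranchIMCGreenbergDischarged
import Summits.BirchSwinnertonDyer.BirchSwinnertonDyer.Theorems.SignedBaseChangeAnticyclotomicEisensteinDivisibilityLocalEulerPoincareCorank
import Literature.NumberTheory.IwasawaTheory.Greenberg2006.LocalH2VanishingOfLOC1
import HarnessLib

/-!
# Route `SchneiderFreeAdditiveX3` (K1 door): the `p = 3` ANOMALOUS column, part 1 — the bad-place corank inequality and the V21 index-road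
# input package for the anomalous `(−3)`-twist RE-TYPED GREENBERG-FREE: Greenberg 2016 Prop. 2.6.3 ↦ its case (c) at totally complex `K`
# ⟸ Milne ADT I Thm. 4.10 (a) (cell `bsd-eis` road «SUR-Λ»); Greenberg 2006 Props. 3.2 / 4.1 / 4.2 / §5 A and Tate's Euler characteristic at
# totally complex fields fed by tree theorems

Cell `bsd-schneider-ideate`, seat `bsd-schneider-door-c5` (prover, generation 40; assembly layer; `--supports` 19177).  PARTITION: board row
B6 ∩ X3 ∩ sst-twist, `r = 1`, (G-ord, `e = 2`) half at `p = 3`, ANOMALOUS twist (1 725 of 2 411 pairs; class-wide) of `Rank1Residual.partition` —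
ASSEMBLY; types-the-object-of nothing new; RE-KEYS generation 31's `BadPrimeCharImprimitiveShift` §3–§4 and `AnomalousTwistIndexInputs` §2 off
Greenberg's papers (the anomalous twin of F38a/F39a of this generation); closes none of B6's cells (BSD NOT advanced).  bears_on: K1-door (19177 r3).

WHAT.  The ONE displayed input replacing {Greenberg 2016 Prop. 2.6.3, Greenberg 2006 ×4} is `hPT` = Milne ADT I Thm. 4.10 (a) at finite `S` over totally
complex fields (`poitouTate_shaRestricted_tateDual_natural_at`; the statement cell `bsd-eis`'s lane «PT-Ш-S-TC» is proving).  Inside each proof the five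
old names are RE-BOUND to tree terms — `h263 := SurLambda.prop263_sur_of_crk_caseC_tc_of_poitouTateNaturalAt hPT` (Prop. 2.6.3 (c), totally complex),
`h41 := KYBranchGreenbergDischarged.greenberg2006_prop41_ofTree`, `h42 := prop42_…_holds`, `h5A := sec5A_…_holds`, `h32 := forall_tateGlobalEulerPoincare
Characteristic_of_isTotallyComplex` — and the bodies are generation 31's VERBATIM with cell `bsd-eis`'s re-typed engines called
(`AcTwistDeformation.exists_mem_unrSelmer_forall_resOfLe_conjH1_eq_ofSurC`, `IndexInputsShell.sur_package_ofSurC`, `IndexInputsH2.natCard_H2_conjunct_ofTateTC`).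
* §1 (namespace `BadPrimeCharImprimitiveShiftOfPT`) `sum_charLocalLambda_le_zpCorank_unrSelmer_quotient_of_not_good`, `imprimitive_clauses_of_not_good`.
* §2 (namespace `AnomalousTwistIndexInputsOfPT`) `indexInputs_anomalousTwist` (the 35-conjunct package; `hCD2` still displayed, discharged upstream as before).

HONEST FRAMING: compositions of tree theorems, CONDITIONAL BY NAME on the displayed statements; no definition, no named fact, no `sorry`; nothing analytic;
nothing is closed; BSD proved for no curve; «closes rung: none».  References: [KellerYin2024] Props. 1.2.5, 1.3.2, Thm. 1.4.1, Rem. 1.4.2;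
[CastellaGrossiLeeSkinner2022] Prop. 1.2.5, Lemma 1.1.1; [Greenberg2016Selmer] Prop. 2.6.3 (c); [Greenberg2010] Prop. 3.2.1 (c); [Greenberg2006] Props. 3.2, 4.1,
4.2, §5 A; [MilneADT2006] I Thms. 4.10 (a), 5.1; [NeukirchSchmidtWingberg2008] (8.3.18); [PollackWeston2011] Prop. A.2; this seat p712xxx (gen 31); cell
`bsd-eis` `…IndexInputsShellOfSurC`, `…IndexInputsH2OfTateTC`, `…AcTwistDeformationLocSurjOfSurC`, `…SurLambdaCaseCTCOfPoitouTateAt`.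
-/

set_option autoImplicit false
set_option linter.dupNamespace false -- the route's Theorems namespace repeats the summit name by design (D-0017 nested layout)

noncomputable section

open scoped Classical

open NumberField IsDedekindDomain Field Multiplicative PowerSeries WeierstrassCurve
open Literature.NumberTheory.EllipticCurves Literature.NumberTheory.EllipticCurves.GreenbergSelmer
  Literature.NumberTheory.EllipticCurves.GreenbergVatsal2000 Literature.NumberTheory.GaloisRepresentations
  Literature.NumberTheory.EllipticCurves.KellerYin2024 Literature.NumberTheory.EllipticCurves.IwasawaDual
  Literature.NumberTheory.EllipticCurves.Rank1Residual Literature.NumberTheory.EllipticCurves.Castella2018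
  Literature.NumberTheory.QuadraticFields Literature.NumberTheory.EllipticCurves.IwasawaAlgebra
  Literature.NumberTheory.IwasawaTheory Literature.NumberTheory.IwasawaTheory.Greenberg2016
  Literature.NumberTheory.IwasawaTheory.Greenberg2006 Literature.NumberTheory.GaloisCohomology
  Literature.NumberTheory.EllipticCurves.FineSelmerCoefficientMap
  Summit.BirchSwinnertonDyer.Rank1Residual.X2.ResidualDevissageModules
  Summit.BirchSwinnertonDyer.BirchSwinnertonDyer.Theorems
  Summit.BirchSwinnertonDyer.BirchSwinnertonDyer.Theorems.GreenbergFullAtSelmer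
  Summit.BirchSwinnertonDyer.BirchSwinnertonDyer.Theorems.AcTwistDeformationResidualPair
  Summit.BirchSwinnertonDyer.BirchSwinnertonDyer.Theorems.UnrSelmerQuotientTorsionFiniteChar
  Summit.BirchSwinnertonDyer.BirchSwinnertonDyer.Theorems.AcTwistDeformation
  Summit.BirchSwinnertonDyer.BirchSwinnertonDyer.Theorems.IndexInputsShell
  Summit.BirchSwinnertonDyer.BirchSwinnertonDyer.Theorems.SchneiderFreeAdditiveX3

namespace Summit.BirchSwinnertonDyer.BirchSwinnertonDyer.Theorems.SchneiderFreeAdditiveX3.BadPrimeCharImprimitiveShiftOfPT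

/-! ### §1 The bad-place corank inequality and the imprimitive clauses, Greenberg-free -/

variable {K : Type} [Field K] [NumberField K] {p : ℕ} [hp : Fact p.Prime]

/-- **CGLS Prop. 1.2.5's corank inequality `Σ_{w∈Sf} λ(𝒫_w(θ)) ≤ corank_{ℤ_p}(H¹_{𝓕_nr^{Sf}}/H¹_{𝓕_nr})` for an UNRAMIFIED-twisted character datum at a bad place,
Greenberg-free** — generation 31's `BadPrimeCharImprimitiveShift.sum_charLocalLambda_le_zpCorank_unrSelmer_quotient_of_not_good` with the global-to-local
surjectivity taken from cell `bsd-eis`'s `AcTwistDeformation.exists_mem_unrSelmer_forall_resOfLe_conjH1_eq_ofSurC` (Greenberg 2016 Prop. 2.6.3 (c) at totally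
complex `K` ⟸ Milne ADT I Thm. 4.10 (a) via road «SUR-Λ» `SurLambda.prop263_sur_of_crk_caseC_tc_of_poitouTateNaturalAt`; Greenberg 2006 Props. 4.1 / 4.2 / §5 A
and Tate's Euler characteristic at totally complex fields are tree theorems).  Every other step token-identical.
[cite: CastellaGrossiLeeSkinner2022, §1.2 Prop. 1.2.5 and proof (eq:sur2), Lemma 1.1.1] [cite: KellerYin2024, Prop. 1.2.5, Rem. 1.4.2 (arXiv:2402.12781v2)]
[cite: Greenberg2016Selmer, Prop. 2.6.3 (c) (its consumed instance)] [cite: MilneADT2006, I Thm. 4.10 (a)] [cite: PollackWeston2011, App. A Prop. A.2] -/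
theorem sum_charLocalLambda_le_zpCorank_unrSelmer_quotient_of_not_good (hPT : ∀ (L : Type) [Field L] [NumberField L] [IsTotallyComplex L] (S : Set (HeightOneSpectrum (𝓞 L))),
      S.Finite → Literature.NumberTheory.GaloisCohomology.poitouTate_shaRestricted_tateDual_natural_at L S)
    (W : WeierstrassCurve ℚ) [W.IsElliptic] [W.IsGloballyMinimal] (hp : 2 < p)
    (hbad : ¬ W.HasGoodReductionAtPrime p) (hK : IsImaginaryQuadratic K)
    (hH : SatisfiesHeegnerHypothesis (W.conductorNorm ℤ) K)
    {ι : K →+* ℚ_[p]} {v vbar : HeightOneSpectrum (𝓞 K)} (hvι : ∀ x : 𝓞 K, x ∈ v.asIdeal ↔ ‖ι (x : K)‖ < 1)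
    (hvbar : ((p : ℕ) : 𝓞 K) ∈ vbar.asIdeal) (hne : vbar ≠ v)
    (κ : ZpExtension K p) (hκ : κ.IsAnticyclotomic) (γ : absoluteGaloisGroup K) [Fact (κ.IsTopGenerator γ)]
    {θsub θquot : FramedGaloisRep K (padicCoeffIntegers (∅ : Set (PadicAlgCl p))) 1}
    (hpair : IsResidualPairOver (W.baseChange K) p θsub θquot)
    (Sf : Finset (HeightOneSpectrum (𝓞 K)))
    (hSf : ∀ w : HeightOneSpectrum (𝓞 K), w ∈ Sf ↔
      (((W.conductorNorm ℤ : ℤ) : 𝓞 K) ∈ w.asIdeal ∧ ((p : ℕ) : 𝓞 K) ∉ w.asIdeal))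
    (θ : FramedGaloisRep K (padicCoeffIntegers (∅ : Set (PadicAlgCl p))) 1) (hθ : θ = θsub ∨ θ = θquot)
    (hRH : ∀ D : DatumDualData κ γ (charModule ∅ θ)
        (AcSelmer.bdpData (charModule ∅ θ) p vbar) (∅ : Set (HeightOneSpectrum (𝓞 K))),
      Module.Finite (IwasawaAlgebra p) D.X ∧ Module.IsTorsion (IwasawaAlgebra p) D.X ∧ muInvariant p D.X = 0) :
    ∑ w ∈ Sf, charLocalLambda ∅ κ θ w ≤
      zpCorank (↥(unrSelmer κ (charModule ∅ θ) vbar (↑Sf : Set (HeightOneSpectrum (𝓞 K)))) ⧸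
        (unrSelmer κ (charModule ∅ θ) vbar (∅ : Set (HeightOneSpectrum (𝓞 K)))).addSubgroupOf
          (unrSelmer κ (charModule ∅ θ) vbar (↑Sf : Set (HeightOneSpectrum (𝓞 K))))) p := by
  have h263 := SurLambda.prop263_sur_of_crk_caseC_tc_of_poitouTateNaturalAt hPT
  have h41 := KYBranchGreenbergDischarged.greenberg2006_prop41_ofTree
  have h42 := Greenberg2006.prop42_localEulerPoincareCorank_holds
  have h5A := Greenberg2006.sec5A_localH2_subsingleton_of_LOC1_holds
  have h32 := Literature.NumberTheory.GaloisCohomology.forall_tateGlobalEulerPoincareCharacteristic_of_isTotallyComplex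
  have hγ : κ.IsTopGenerator γ := Fact.out
  have hv : ((p : ℕ) : 𝓞 K) ∈ v.asIdeal := IwasawaTwoVariable.natCast_mem_asIdeal_of_norm_iff hvι
  have hN0 : W.conductorNorm ℤ ≠ 0 := (W.conductorNorm_pos_holds).ne'
  set N' : ℕ := W.conductorNorm ℤ / p ^ (W.conductorNorm ℤ).factorization p with hN'def
  have hH' : SatisfiesHeegnerHypothesis N' K := hH.of_dvd (Nat.ordCompl_dvd (W.conductorNorm ℤ) p)
  have hSf' : ∀ w : HeightOneSpectrum (𝓞 K), w ∈ Sf ↔ ((N' : ℤ) : 𝓞 K) ∈ w.asIdeal := fun w ↦ by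
    rw [hSf, hN'def, SplitMultCharImprimitiveShift.intCast_ordCompl_mem_iff hN0]
  have hSfp : ∀ w ∈ Sf, ((p : ℕ) : 𝓞 K) ∉ w.asIdeal := fun w hw ↦ ((hSf w).mp hw).2
  have hSp : ∀ w : HeightOneSpectrum (𝓞 K), ((p : ℕ) : 𝓞 K) ∈ w.asIdeal → w = v ∨ w = vbar :=
    fun w hw ↦ eq_or_eq_of_natCast_mem_of_ne hK.1 hv hvbar hne hw
  have hθpow : ∀ σ : absoluteGaloisGroup K, θ σ ^ (p - 1) = 1 := fun σ ↦ by
    rcases hθ with rfl | rfl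
    · exact (hpair.pow_sub_one σ).1
    · exact (hpair.pow_sub_one σ).2
  have hdec : ∀ w ∈ Sf, ¬ decomp (K := K) w ≤ κ.kerSubgroup := fun w hw hle ↦ by
    obtain ⟨δ, hδ, hne1⟩ := exists_mem_decomp_apply_ne_one_of_heegner hK hp hH' κ hκ w ((hSf' w).mp hw)
      (hSfp w hw)
    exact hne1 (ZpExtension.mem_kerSubgroup.mp (hle hδ))
  have hexp : ∀ w : HeightOneSpectrum (𝓞 K), ∃ a : ℕ, w ∈ Sf →
      (∃ δ ∈ decomp (K := K) w, (κ δ).toAdd = (p : ℤ_[p]) ^ a) ∧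
        ∀ δ ∈ decomp (K := K) w, (p : ℤ_[p]) ^ a ∣ (κ δ).toAdd := by
    intro w
    by_cases hw : w ∈ Sf
    · obtain ⟨c, ⟨d₀, hd₀⟩, -, hdvd⟩ :=
        UniversalToricDescentSigmaLocalStabilizer.exists_pow_and_forall_dvd_of_not_le κ w (hdec w hw)
      exact ⟨c, fun _ ↦ ⟨⟨d₀, d₀.2, hd₀⟩, fun δ hδ ↦ hdvd ⟨δ, hδ⟩⟩⟩
    · exact ⟨0, fun h ↦ (hw h).elim⟩
  choose a ha using hexp
  have hd₀ : ∀ w ∈ Sf, ∃ δ ∈ decomp (K := K) w, (κ δ).toAdd = (p : ℤ_[p]) ^ a w :=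
    fun w hw ↦ (ha w hw).1
  have hdiv : ∀ w ∈ Sf, ∀ δ ∈ decomp (K := K) w, (p : ℤ_[p]) ^ a w ∣ (κ δ).toAdd :=
    fun w hw ↦ (ha w hw).2
  have hσrep : ∀ w ∈ Sf, ∀ i : ℕ, i < p ^ a w → (κ ((fun (_ : HeightOneSpectrum (𝓞 K)) (i : ℕ) ↦ γ ^ i) w i)).toAdd =
      (i : ℤ_[p]) := fun w _ i _ ↦ by
    change (κ (γ ^ i)).toAdd = (i : ℤ_[p])
    rw [map_pow, show κ γ = Multiplicative.ofAdd 1 from hγ, ← ofAdd_nsmul, toAdd_ofAdd, nsmul_one]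
  have hS : ∀ w : HeightOneSpectrum (𝓞 K), ((p : ℕ) : 𝓞 K) ∈ w.asIdeal →
      w ∈ (↑(insert v (insert vbar Sf)) : Set (HeightOneSpectrum (𝓞 K))) :=
    mem_insert_insert_of_natCast_mem hK hv hvbar hne Sf
  have hSfS : ∀ w ∈ Sf, w ∈ (↑(insert v (insert vbar Sf)) : Set (HeightOneSpectrum (𝓞 K))) :=
    fun w hw ↦ by
    rw [Finset.coe_insert, Finset.coe_insert]
    exact Or.inr (Or.inr (Finset.mem_coe.mpr hw))
  have hSN : ∀ w : HeightOneSpectrum (𝓞 K), w ∈ insert v (insert vbar Sf) ↔ ((W.conductorNorm ℤ : ℤ) : 𝓞 K) ∈ w.asIdeal :=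
    BadPrimeCharImprimitiveShift.mem_insert_insert_iff_conductorNorm_mem_of_not_good W hbad hK hv hvbar hne Sf hSf
  have h : ramificationSubgroup K (↑(insert v (insert vbar Sf)) : Set (HeightOneSpectrum (𝓞 K))) ≤
      (unitChar θ).toMonoidHom.ker :=
    ramificationSubgroup_le_ker_unitChar_of_residualPair W hpair (insert v (insert vbar Sf)) hSN _ (fun _ hw ↦ hw) hS θ hθ
  letI tΛ : TopologicalSpace (PowerSeries ℤ_[p]) := ⊥
  haveI : DiscreteTopology (PowerSeries ℤ_[p]) := ⟨rfl⟩
  haveI : IsTopologicalRing (PowerSeries ℤ_[p]) := inferInstance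
  haveI hAdisc : DiscreteTopology (QpModZp p) := QpModZp.discreteTopology p
  haveI : IsTopologicalAddGroup (BigRepModule ℤ_[p] p (QpModZp p)) := inferInstance
  haveI : ContinuousSMul (PowerSeries ℤ_[p]) (BigRepModule ℤ_[p] p (QpModZp p)) := inferInstance
  have hψ := charModuleEquiv_symm_galois (↑(insert v (insert vbar Sf)) : Set (HeightOneSpectrum (𝓞 K))) θ h
  obtain ⟨F, hF⟩ := exists_shapiroDescent _ hS κ (characterRepUnramified _ θ h) (charModuleEquiv θ).symm hψ
  obtain ⟨hSel, hSelfg⟩ := hasCorank_fullAtSelmer_zero_of_RH hK κ hγ hv hvbar hne θ _ hS h hRH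
  have h8 : ∀ y : ∀ w : HeightOneSpectrum (𝓞 K), ℕ →
      subgroupH1 (κ.kerSubgroup ⊓ decomp (K := K) w) (charModule (∅ : Set (PadicAlgCl p)) θ),
      ∃ u ∈ unrSelmer κ (charModule (∅ : Set (PadicAlgCl p)) θ) vbar (↑Sf : Set (HeightOneSpectrum (𝓞 K))),
        ∀ w ∈ Sf, ∀ i : ℕ, i < p ^ a w →
          resOfLe (charModule (∅ : Set (PadicAlgCl p)) θ)
            (inf_le_left : κ.kerSubgroup ⊓ decomp (K := K) w ≤ κ.kerSubgroup)
            (conjH1 κ.kerSubgroup (charModule (∅ : Set (PadicAlgCl p)) θ) (γ ^ i) u) = y w i := fun y ↦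
    exists_mem_unrSelmer_forall_resOfLe_conjH1_eq_ofSurC _ hS κ (characterRepUnramified _ θ h)
      (charModuleEquiv θ).symm hψ h263 h41 h42 h5A h32 (Finset.finite_toSet _) hK
      (LinearEquiv.refl ℤ_[p] (QpModZp p)) (characterRepUnramified_hscalar _ θ h)
      (fun w hw ↦ exists_local_apply_ne_one_of_mem_insert_insert hK hp hH κ hκ hv hvbar (insert v (insert vbar Sf)) hSN w
        (by rw [Finset.coe_insert, Finset.coe_insert]; exact Or.inr (Or.inr hw)))
      hne hv hvbar hSp hSel hSelfg (fun b ↦ QpModZp.exists_pow_nsmul_eq_zero b) hF Sf hSfS hSfp a hdiv hd₀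
      (fun _ i ↦ γ ^ i) hσrep y
  exact UnrSelmerLocSurjAdapter.sum_charLocalLambda_le_zpCorank_unrSelmer_quotient_of_forall_exists κ θ vbar Sf hθpow hγ hSfp
    (fun w hw ↦ exists_mem_decomp_apply_ne_one_of_heegner hK hp hH' κ hκ w ((hSf' w).mp hw) (hSfp w hw)) a hdiv hd₀
    (fun _ i ↦ γ ^ i) hσrep h8

/-- **The imprimitive clauses at a bad place off `p` for an unramified-twisted character datum, Greenberg-free** — generation 31's
`BadPrimeCharImprimitiveShift.imprimitive_clauses_of_not_good` on the theorem above. [cite: CastellaGrossiLeeSkinner2022, §1.2 Prop. 1.2.5]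
[cite: KellerYin2024, Prop. 1.2.5 (arXiv:2402.12781v2)] [cite: MilneADT2006, I Thm. 4.10 (a)] -/
theorem imprimitive_clauses_of_not_good (hPT : ∀ (L : Type) [Field L] [NumberField L] [IsTotallyComplex L] (S : Set (HeightOneSpectrum (𝓞 L))),
      S.Finite → Literature.NumberTheory.GaloisCohomology.poitouTate_shaRestricted_tateDual_natural_at L S)
    (W : WeierstrassCurve ℚ) [W.IsElliptic] [W.IsGloballyMinimal] (hp : 2 < p)
    (hbad : ¬ W.HasGoodReductionAtPrime p) (hK : IsImaginaryQuadratic K)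
    (hH : SatisfiesHeegnerHypothesis (W.conductorNorm ℤ) K)
    {ι : K →+* ℚ_[p]} {v vbar : HeightOneSpectrum (𝓞 K)} (hvι : ∀ x : 𝓞 K, x ∈ v.asIdeal ↔ ‖ι (x : K)‖ < 1)
    (hvbar : ((p : ℕ) : 𝓞 K) ∈ vbar.asIdeal) (hne : vbar ≠ v)
    (κ : ZpExtension K p) (hκ : κ.IsAnticyclotomic) (γ : absoluteGaloisGroup K) [Fact (κ.IsTopGenerator γ)]
    {θsub θquot : FramedGaloisRep K (padicCoeffIntegers (∅ : Set (PadicAlgCl p))) 1}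
    (hpair : IsResidualPairOver (W.baseChange K) p θsub θquot)
    (Sf : Finset (HeightOneSpectrum (𝓞 K)))
    (hSf : ∀ w : HeightOneSpectrum (𝓞 K), w ∈ Sf ↔
      (((W.conductorNorm ℤ : ℤ) : 𝓞 K) ∈ w.asIdeal ∧ ((p : ℕ) : 𝓞 K) ∉ w.asIdeal))
    (θ : FramedGaloisRep K (padicCoeffIntegers (∅ : Set (PadicAlgCl p))) 1) (hθ : θ = θsub ∨ θ = θquot)
    (hRH : ∀ D : DatumDualData κ γ (charModule ∅ θ)
        (AcSelmer.bdpData (charModule ∅ θ) p vbar) (∅ : Set (HeightOneSpectrum (𝓞 K))),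
      Module.Finite (IwasawaAlgebra p) D.X ∧ Module.IsTorsion (IwasawaAlgebra p) D.X ∧ muInvariant p D.X = 0)
    (D : DatumDualData κ γ (charModule ∅ θ) (AcSelmer.bdpData (charModule ∅ θ) p vbar) (∅ : Set (HeightOneSpectrum (𝓞 K))))
    (DS : DatumDualData κ γ (charModule ∅ θ) (AcSelmer.bdpData (charModule ∅ θ) p vbar) (↑Sf : Set (HeightOneSpectrum (𝓞 K)))) :
    Module.Finite (IwasawaAlgebra p) DS.X ∧ Module.IsTorsion (IwasawaAlgebra p) DS.X ∧ muInvariant p DS.X = 0 ∧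
      lambdaInvariant p DS.X = lambdaInvariant p D.X + ∑ w ∈ Sf, charLocalLambda ∅ κ θ w := by
  have h263 := SurLambda.prop263_sur_of_crk_caseC_tc_of_poitouTateNaturalAt hPT
  have h41 := KYBranchGreenbergDischarged.greenberg2006_prop41_ofTree
  have h42 := Greenberg2006.prop42_localEulerPoincareCorank_holds
  have h5A := Greenberg2006.sec5A_localH2_subsingleton_of_LOC1_holds
  have h32 := Literature.NumberTheory.GaloisCohomology.forall_tateGlobalEulerPoincareCharacteristic_of_isTotallyComplex
  have hγ : κ.IsTopGenerator γ := Fact.out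
  have hN0 : W.conductorNorm ℤ ≠ 0 := (W.conductorNorm_pos_holds).ne'
  set N' : ℕ := W.conductorNorm ℤ / p ^ (W.conductorNorm ℤ).factorization p with hN'def
  have hH' : SatisfiesHeegnerHypothesis N' K := hH.of_dvd (Nat.ordCompl_dvd (W.conductorNorm ℤ) p)
  have hSf' : ∀ w : HeightOneSpectrum (𝓞 K), w ∈ Sf ↔ ((N' : ℤ) : 𝓞 K) ∈ w.asIdeal := fun w ↦ by
    rw [hSf, hN'def, SplitMultCharImprimitiveShift.intCast_ordCompl_mem_iff hN0]
  have hSfp : ∀ w ∈ Sf, ((p : ℕ) : 𝓞 K) ∉ w.asIdeal := fun w hw ↦ ((hSf w).mp hw).2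
  -- the corank IDENTITY of the quotient
  have hge := sum_charLocalLambda_le_zpCorank_unrSelmer_quotient_of_not_good hPT W hp hbad hK hH hvι hvbar hne κ hκ
    γ hpair Sf hSf θ hθ hRH
  have hle := UnrSelmerQuotientCorankLocalLambda.zpCorank_unrSelmer_quotient_le_at_residualPair hK hp hH' κ hκ hγ vbar θsub θquot
    hpair Sf hSf' hSfp θ hθ
  have hcork := le_antisymm hle hge
  -- finiteness of the `p`-torsion of the quotient, and GV Cor. (2.3)
  have hQ := UnrSelmerQuotientTorsionFiniteChar.finite_torsionBy_unrSelmer_quotient hK hp hH' κ hκ hγ vbar θ Sf hSf'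
  obtain ⟨hfg, htors, hμ⟩ := hRH D
  haveI := hfg
  obtain ⟨hfgS, htorsS, hμS, hlamS⟩ :=
    UnrSelmerImprimitiveFiniteness.moduleFinite_isTorsion_mu_lambda_of_primitive κ vbar
      (exists_pow_smul_cofree_eq_zero (∅ : Set (PadicAlgCl p)) θ)
      (isOpen_stabilizer_cofree (∅ : Set (PadicAlgCl p)) θ) hγ
      (Set.empty_subset (↑Sf : Set (HeightOneSpectrum (𝓞 K)))) D htors DS hQ
  exact ⟨hfgS, htorsS, hμS.trans hμ, by rw [hlamS, hcork]⟩

end Summit.BirchSwinnertonDyer.BirchSwinnertonDyer.Theorems.SchneiderFreeAdditiveX3.BadPrimeCharImprimitiveShiftOfPT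

namespace Summit.BirchSwinnertonDyer.BirchSwinnertonDyer.Theorems.SchneiderFreeAdditiveX3.AnomalousTwistIndexInputsOfPT

/-! ### §2 The V21 index-road input package for the anomalous `(−3)`-twist, Greenberg-free -/

/-- **THE ∃-PACKAGE OF INPUTS of the V21 index road (35 conjuncts: (R), Kummer, (U), SUR ×3, COT ×6, H⁰ ×13, H²) FOR THE ANOMALOUS `(−3)`-TWIST,
orientation `(ω, 𝟙)`, Greenberg-free** — generation 31's `AnomalousTwistIndexInputs.indexInputs_anomalousTwist` with SUR ×3 from cell `bsd-eis`'s
`IndexInputsShell.sur_package_ofSurC` (Greenberg 2016 Prop. 2.6.3 (c) at totally complex `K` ⟸ Milne ADT I Thm. 4.10 (a), road «SUR-Λ») and the `H²` conjunct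
from `IndexInputsH2.natCard_H2_conjunct_ofTateTC` (Tate's Euler characteristic at totally complex fields, a tree theorem); `cd_3(G_{K,Σ}) ≤ 2` carried as `hCD2`
as before.  Every other step token-identical. [cite: KellerYin2024, Prop. 1.3.2, Thm. 1.4.1, §1.4 (arXiv:2402.12781v2)]
[cite: Greenberg2016Selmer, Prop. 2.6.3 (c) (its consumed instance)] [cite: MilneADT2006, I Thm. 4.10 (a), I Thm. 5.1] [cite: NeukirchSchmidtWingberg2008, (8.3.18)] -/
theorem indexInputs_anomalousTwist {V : WeierstrassCurve ℚ} [V.IsElliptic] [V.IsGloballyMinimal]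
    (hPT : ∀ (L : Type) [Field L] [NumberField L] [IsTotallyComplex L] (S : Set (HeightOneSpectrum (𝓞 L))),
      S.Finite → Literature.NumberTheory.GaloisCohomology.poitouTate_shaRestricted_tateDual_natural_at L S)
    (W : WeierstrassCurve ℚ) [W.IsElliptic] [W.IsGloballyMinimal] (p : ℕ) [Fact p.Prime]
    (hp : 2 < p) (hp3 : p = 3) (hV : GoodOrd V p) (ha : (p : ℤ) ∣ V.frobeniusTrace p - 1)
    (C : VariableChange ℚ) (hC : C • V.quadraticTwist ((-1 : ℚ) ^ (p / 2) * p) = W)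
    (K : Type) [Field K] [NumberField K] (hK : IsImaginaryQuadratic K)
    (hCD2 : groupCdLE_two_galoisGroupUnramifiedOutside K)
    (hH : SatisfiesHeegnerHypothesis (W.conductorNorm ℤ) K)
    (htor : ∀ Q : (W.baseChange K).toAffine.Point, p • Q = 0 → Q = 0)
    (ι : K →+* ℚ_[p]) (v vbar : HeightOneSpectrum (𝓞 K))
    (hv : ∀ x : 𝓞 K, x ∈ v.asIdeal ↔ ‖ι (x : K)‖ < 1)
    (hvbar : ((p : ℕ) : 𝓞 K) ∈ vbar.asIdeal) (hne : vbar ≠ v)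
    (κ : ZpExtension K p) (hκ : κ.IsAnticyclotomic)
    (γ : absoluteGaloisGroup K) [Fact (κ.IsTopGenerator γ)]
    (θsub θquot : FramedGaloisRep K (padicCoeffIntegers (∅ : Set (PadicAlgCl p))) 1)
    (hpair : IsResidualPairOver (W.baseChange K) p θsub θquot)
    (hram : ∃ τ ∈ decomp vbar, unitChar θsub τ ≠ 1)
    (hfinED : Finite {x : ↥((W.baseChange K).geomPrimaryTorsion p) // ∀ g : ↥(κ.kerSubgroup ⊓ decomp vbar), g • x = x})
    (Sf : Finset (HeightOneSpectrum (𝓞 K)))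
    (hSf : ∀ w : HeightOneSpectrum (𝓞 K), w ∈ Sf ↔ ((W.conductorNorm ℤ : ℤ) : 𝓞 K) ∈ w.asIdeal)
    (hfgS : Module.Finite (IwasawaAlgebra p) (AcSelmer.XAc (W.baseChange K) p κ vbar (↑Sf : Set (HeightOneSpectrum (𝓞 K))) γ))
    (htorS : Module.IsTorsion (IwasawaAlgebra p) (AcSelmer.XAc (W.baseChange K) p κ vbar (↑Sf : Set (HeightOneSpectrum (𝓞 K))) γ))
    (hμS : muInvariant p (AcSelmer.XAc (W.baseChange K) p κ vbar (↑Sf : Set (HeightOneSpectrum (𝓞 K))) γ) = 0)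
    (hSsub : ∀ D : DatumDualData κ γ (charModule ∅ θsub)
        (AcSelmer.bdpData (charModule ∅ θsub) p vbar) (↑Sf : Set (HeightOneSpectrum (𝓞 K))),
      Module.Finite (IwasawaAlgebra p) D.X ∧ Module.IsTorsion (IwasawaAlgebra p) D.X ∧ muInvariant p D.X = 0)
    (hSquot : ∀ D : DatumDualData κ γ (charModule ∅ θquot)
        (AcSelmer.bdpData (charModule ∅ θquot) p vbar) (↑Sf : Set (HeightOneSpectrum (𝓞 K))),
      Module.Finite (IwasawaAlgebra p) D.X ∧ Module.IsTorsion (IwasawaAlgebra p) D.X ∧ muInvariant p D.X = 0) :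
      ∃ (c : ℕ) (τ : ℕ → absoluteGaloisGroup K)
        (Φ : StableSubgroup (absoluteGaloisGroup K) ↥((W.baseChange K).geomTorsion (p : ℤ)))
        (j₁ : Φ.Sub →+ charModule ∅ θsub) (j₃ : Φ.Quot →+ charModule ∅ θquot)
        (hj₁ : ∀ (g : absoluteGaloisGroup K) (a : Φ.Sub), j₁ (g • a) = g • j₁ a)
        (hj₃ : ∀ (g : absoluteGaloisGroup K) (a : Φ.Quot), j₃ (g • a) = g • j₃ a),
        -- (R) representatives
        (∀ i : ℕ, κ (τ i) = Multiplicative.ofAdd ((i : ℕ) : ℤ_[p])) ∧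
        (∀ i j : ℕ, i < p ^ c → j < p ^ c → i ≠ j → ∀ δ ∈ decomp vbar,
          Multiplicative.ofAdd ((j : ℕ) : ℤ_[p]) ≠ Multiplicative.ofAdd ((i : ℕ) : ℤ_[p]) * κ δ) ∧
        (∀ x : subgroupH1 κ.kerSubgroup (charModule ∅ θsub),
          (∀ i, i < p ^ c → resOfLe (charModule ∅ θsub) (inf_le_left : κ.kerSubgroup ⊓ decomp vbar ≤ κ.kerSubgroup) (conjH1 κ.kerSubgroup (charModule ∅ θsub) (τ i) x) = 0) →
            ∀ σ : absoluteGaloisGroup K, resOfLe (charModule ∅ θsub) (inf_le_left : κ.kerSubgroup ⊓ decomp vbar ≤ κ.kerSubgroup) (conjH1 κ.kerSubgroup (charModule ∅ θsub) σ x) = 0) ∧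
        (∀ x : subgroupH1 κ.kerSubgroup ↥((W.baseChange K).geomPrimaryTorsion p),
          (∀ i, i < p ^ c → resOfLe ↥((W.baseChange K).geomPrimaryTorsion p) (inf_le_left : κ.kerSubgroup ⊓ decomp vbar ≤ κ.kerSubgroup) (conjH1 κ.kerSubgroup ↥((W.baseChange K).geomPrimaryTorsion p) (τ i) x) = 0) →
            ∀ σ : absoluteGaloisGroup K, resOfLe ↥((W.baseChange K).geomPrimaryTorsion p) (inf_le_left : κ.kerSubgroup ⊓ decomp vbar ≤ κ.kerSubgroup) (conjH1 κ.kerSubgroup ↥((W.baseChange K).geomPrimaryTorsion p) σ x) = 0) ∧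
        (∀ x : subgroupH1 κ.kerSubgroup (charModule ∅ θquot),
          (∀ i, i < p ^ c → resOfLe (charModule ∅ θquot) (inf_le_left : κ.kerSubgroup ⊓ decomp vbar ≤ κ.kerSubgroup) (conjH1 κ.kerSubgroup (charModule ∅ θquot) (τ i) x) = 0) →
            ∀ σ : absoluteGaloisGroup K, resOfLe (charModule ∅ θquot) (inf_le_left : κ.kerSubgroup ⊓ decomp vbar ≤ κ.kerSubgroup) (conjH1 κ.kerSubgroup (charModule ∅ θquot) σ x) = 0) ∧
        -- the Kummer embeddings
        Function.Injective j₁ ∧ Function.Injective j₃ ∧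
        (∀ x : charModule ∅ θsub, x ∈ j₁.range ↔ p • x = 0) ∧ (∀ x : charModule ∅ θquot, x ∈ j₃.range ↔ p • x = 0) ∧
        (∀ x : ↥((W.baseChange K).geomPrimaryTorsion p), x ∈ (AddSubgroup.inclusion (geomTorsion_le_geomPrimaryTorsion (W.baseChange K) p)).range ↔ p • x = 0) ∧
        (∀ x : ↥((W.baseChange K).geomPrimaryTorsion p), ∃ x' : ↥((W.baseChange K).geomPrimaryTorsion p), p • x' = x) ∧
        -- (U)
        (∀ w : HeightOneSpectrum (𝓞 K), w ∉ (↑Sf : Set (HeightOneSpectrum (𝓞 K))) → ((p : ℕ) : 𝓞 K) ∉ w.asIdeal →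
          Function.Injective (resH1Hom (ContinuousMonoidHom.id (inertiaIn κ.kerSubgroup w)) Φ.incl
            (fun g m ↦ Φ.incl_smul ((g : decomp (K := K) w) : absoluteGaloisGroup K) m))) ∧
        (∀ w : HeightOneSpectrum (𝓞 K), w ∉ (↑Sf : Set (HeightOneSpectrum (𝓞 K))) → ((p : ℕ) : 𝓞 K) ∉ w.asIdeal →
          Function.Injective (resH1Hom (ContinuousMonoidHom.id (inertiaIn κ.kerSubgroup w)) j₁
            (fun g m ↦ hj₁ ((g : decomp (K := K) w) : absoluteGaloisGroup K) m))) ∧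
        (∀ w : HeightOneSpectrum (𝓞 K), w ∉ (↑Sf : Set (HeightOneSpectrum (𝓞 K))) → ((p : ℕ) : 𝓞 K) ∉ w.asIdeal →
          Function.Injective (resH1Hom (ContinuousMonoidHom.id (inertiaIn κ.kerSubgroup w)) (AddSubgroup.inclusion (geomTorsion_le_geomPrimaryTorsion (W.baseChange K) p))
            (fun (g : inertiaIn κ.kerSubgroup w) (m : ↥((W.baseChange K).geomTorsion (p : ℤ))) ↦
              (rfl : (AddSubgroup.inclusion (geomTorsion_le_geomPrimaryTorsion (W.baseChange K) p)) (((g : decomp (K := K) w) : absoluteGaloisGroup K) • m) =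
                ((g : decomp (K := K) w) : absoluteGaloisGroup K) • (AddSubgroup.inclusion (geomTorsion_le_geomPrimaryTorsion (W.baseChange K) p)) m)))) ∧
        (∀ w : HeightOneSpectrum (𝓞 K), w ∉ (↑Sf : Set (HeightOneSpectrum (𝓞 K))) → ((p : ℕ) : 𝓞 K) ∉ w.asIdeal →
          Function.Injective (resH1Hom (ContinuousMonoidHom.id (inertiaIn κ.kerSubgroup w)) j₃
            (fun g m ↦ hj₃ ((g : decomp (K := K) w) : absoluteGaloisGroup K) m))) ∧
        -- SUR
        (∀ y : Fin (p ^ c) → subgroupH1 (κ.kerSubgroup ⊓ decomp vbar) (charModule ∅ θsub), ∃ u ∈ unramifiedOutside κ.kerSubgroup (charModule ∅ θsub) p (↑Sf : Set (HeightOneSpectrum (𝓞 K))),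
          ∀ i : Fin (p ^ c), resOfLe (charModule ∅ θsub) (inf_le_left : κ.kerSubgroup ⊓ decomp vbar ≤ κ.kerSubgroup) (conjH1 κ.kerSubgroup (charModule ∅ θsub) (τ i) u) = y i) ∧
        (∀ y : Fin (p ^ c) → subgroupH1 (κ.kerSubgroup ⊓ decomp vbar) ↥((W.baseChange K).geomPrimaryTorsion p), ∃ u ∈ unramifiedOutside κ.kerSubgroup ↥((W.baseChange K).geomPrimaryTorsion p) p (↑Sf : Set (HeightOneSpectrum (𝓞 K))),
          ∀ i : Fin (p ^ c), resOfLe ↥((W.baseChange K).geomPrimaryTorsion p) (inf_le_left : κ.kerSubgroup ⊓ decomp vbar ≤ κ.kerSubgroup) (conjH1 κ.kerSubgroup ↥((W.baseChange K).geomPrimaryTorsion p) (τ i) u) = y i) ∧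
        (∀ y : Fin (p ^ c) → subgroupH1 (κ.kerSubgroup ⊓ decomp vbar) (charModule ∅ θquot), ∃ u ∈ unramifiedOutside κ.kerSubgroup (charModule ∅ θquot) p (↑Sf : Set (HeightOneSpectrum (𝓞 K))),
          ∀ i : Fin (p ^ c), resOfLe (charModule ∅ θquot) (inf_le_left : κ.kerSubgroup ⊓ decomp vbar ≤ κ.kerSubgroup) (conjH1 κ.kerSubgroup (charModule ∅ θquot) (τ i) u) = y i) ∧
        -- COT
        (∀ s : (datumStrictSelmer κ.kerSubgroup (charModule ∅ θsub) p (AcSelmer.bdpData (charModule ∅ θsub) p vbar) (↑Sf : Set (HeightOneSpectrum (𝓞 K)))), ∃ n : ℕ, p ^ n • s = 0) ∧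
        (∀ s : (datumStrictSelmer κ.kerSubgroup ↥((W.baseChange K).geomPrimaryTorsion p) p (AcSelmer.bdpData ↥((W.baseChange K).geomPrimaryTorsion p) p vbar) (↑Sf : Set (HeightOneSpectrum (𝓞 K)))), ∃ n : ℕ, p ^ n • s = 0) ∧
        (∀ s : (datumStrictSelmer κ.kerSubgroup (charModule ∅ θquot) p (AcSelmer.bdpData (charModule ∅ θquot) p vbar) (↑Sf : Set (HeightOneSpectrum (𝓞 K)))), ∃ n : ℕ, p ^ n • s = 0) ∧
        Finite (AddSubgroup.torsionBy (datumStrictSelmer κ.kerSubgroup (charModule ∅ θsub) p (AcSelmer.bdpData (charModule ∅ θsub) p vbar) (↑Sf : Set (HeightOneSpectrum (𝓞 K)))) (p : ℤ)) ∧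
        Finite (AddSubgroup.torsionBy (datumStrictSelmer κ.kerSubgroup ↥((W.baseChange K).geomPrimaryTorsion p) p (AcSelmer.bdpData ↥((W.baseChange K).geomPrimaryTorsion p) p vbar) (↑Sf : Set (HeightOneSpectrum (𝓞 K)))) (p : ℤ)) ∧
        Finite (AddSubgroup.torsionBy (datumStrictSelmer κ.kerSubgroup (charModule ∅ θquot) p (AcSelmer.bdpData (charModule ∅ θquot) p vbar) (↑Sf : Set (HeightOneSpectrum (𝓞 K)))) (p : ℤ)) ∧
        -- global H⁰
        (∀ x : (charModule ∅ θsub), (∀ g : ↥κ.kerSubgroup, g • x = x) → ∃ x' : (charModule ∅ θsub), (∀ g : ↥κ.kerSubgroup, g • x' = x') ∧ p • x' = x) ∧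
        (∀ x : ↥((W.baseChange K).geomPrimaryTorsion p), (∀ g : ↥κ.kerSubgroup, g • x = x) → ∃ x' : ↥((W.baseChange K).geomPrimaryTorsion p), (∀ g : ↥κ.kerSubgroup, g • x' = x') ∧ p • x' = x) ∧
        (∀ x : (charModule ∅ θquot), (∀ g : ↥κ.kerSubgroup, g • x = x) → ∃ x' : (charModule ∅ θquot), (∀ g : ↥κ.kerSubgroup, g • x' = x') ∧ p • x' = x) ∧
        (∀ n : ↥((W.baseChange K).geomTorsion (p : ℤ)), (∀ g : ↥κ.kerSubgroup, g • n = n) → n = 0) ∧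
        Finite {n : Φ.Quot // ∀ g : ↥κ.kerSubgroup, g • n = n} ∧
        Nat.card {n : Φ.Quot // ∀ g : ↥κ.kerSubgroup, g • n = n} = p ^ (if ∀ σ : absoluteGaloisGroup K, θquot σ = 1 then 1 else 0) ∧
        -- local H⁰ at `H ⊓ D_v̄`
        (∀ n : Φ.Sub, (∀ g : ↥(κ.kerSubgroup ⊓ decomp vbar), g • n = n) → n = 0) ∧
        (∀ (g : ↥(κ.kerSubgroup ⊓ decomp vbar)) (n : Φ.Quot), g • n = n) ∧
        Finite Φ.Quot ∧ Nat.card Φ.Quot = p ∧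
        (∀ x : (charModule ∅ θsub), (∀ g : ↥(κ.kerSubgroup ⊓ decomp vbar), g • x = x) → ∃ x' : (charModule ∅ θsub), (∀ g : ↥(κ.kerSubgroup ⊓ decomp vbar), g • x' = x') ∧ p • x' = x) ∧
        (∀ x : (charModule ∅ θquot), (∀ g : ↥(κ.kerSubgroup ⊓ decomp vbar), g • x = x) → ∃ x' : (charModule ∅ θquot), (∀ g : ↥(κ.kerSubgroup ⊓ decomp vbar), g • x' = x') ∧ p • x' = x) ∧
        -- H² bookkeeping
        Nat.card (↥(unramifiedOutside κ.kerSubgroup Φ.Quot p (↑Sf : Set (HeightOneSpectrum (𝓞 K)))) ⧸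
            ((unramifiedOutside κ.kerSubgroup ↥((W.baseChange K).geomTorsion (p : ℤ)) p (↑Sf : Set (HeightOneSpectrum (𝓞 K)))).map (resH1Hom (ContinuousMonoidHom.id ↥κ.kerSubgroup) Φ.proj
              (fun g b ↦ Φ.proj_smul (g : absoluteGaloisGroup K) b))).addSubgroupOf
                (unramifiedOutside κ.kerSubgroup Φ.Quot p (↑Sf : Set (HeightOneSpectrum (𝓞 K))))) *
            Nat.card (ModN (unramifiedOutside κ.kerSubgroup ↥((W.baseChange K).geomPrimaryTorsion p) p (↑Sf : Set (HeightOneSpectrum (𝓞 K)))) p) =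
          Nat.card (ModN (unramifiedOutside κ.kerSubgroup (charModule ∅ θsub) p (↑Sf : Set (HeightOneSpectrum (𝓞 K)))) p) * Nat.card (ModN (unramifiedOutside κ.kerSubgroup (charModule ∅ θquot) p (↑Sf : Set (HeightOneSpectrum (𝓞 K)))) p) := by
  have h263 := SurLambda.prop263_sur_of_crk_caseC_tc_of_poitouTateNaturalAt hPT
  have h41 := KYBranchGreenbergDischarged.greenberg2006_prop41_ofTree
  have h42 := Greenberg2006.prop42_localEulerPoincareCorank_holds
  have h5A := Greenberg2006.sec5A_localH2_subsingleton_of_LOC1_holds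
  have h32 := Literature.NumberTheory.GaloisCohomology.forall_tateGlobalEulerPoincareCharacteristic_of_isTotallyComplex
  haveI hEK : (W.baseChange K).IsElliptic := inferInstanceAs (W.map (algebraMap ℚ K)).IsElliptic
  have hγ : κ.IsTopGenerator γ := Fact.out
  have hpvK : ((p : ℕ) : 𝓞 K) ∈ v.asIdeal := IndexPlumbingNrVsStrict.natCast_mem_asIdeal_of_forall_norm_iff hv
  -- the residual line with its socle embeddings
  obtain ⟨Φ, hSub, hQuot, ⟨j₁, hj₁, hj₁inj, hr₁⟩, ⟨j₃, hj₃, hj₃inj, hr₃⟩⟩ :=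
    ResidualPairStableLine.exists_stableLine_of_isResidualPairOver (W.baseChange K) hpair
  -- the exponent `c` and the representatives `γ ^ i`
  obtain ⟨c, hc, hcd⟩ := IndexInputsReps.exists_pow_generates_decomp_of_isImaginaryQuadratic κ hK hvbar
  obtain ⟨hτ, hdist, hreps⟩ := IndexInputsReps.reps_package_of_pow_generates κ vbar hγ hc hcd
  -- SUR ×3 (x1's package, reduction-free)
  have hsur := sur_package_ofSurC h263 h41 h42 h5A h32 W p hp K hK hH ι v vbar hv hvbar hne κ hκ γ θsub θquot hpair Sf hSf hSsub
    hSquot c hc hcd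
  obtain ⟨hsur₁, hsur₂, hsur₃⟩ := hsur
  -- COT ×6, H⁰ ×13 (anomalous twist)
  have hpack := AnomalousTwistIndexInputs.cot_hZero_package_anomalousTwist W p hp3 hV ha C hC K hK htor vbar hpvK hvbar hne κ γ θsub θquot hpair hram
    hfinED Sf hSf hfgS htorS hμS hSsub hSquot Φ hSub hQuot j₁ hj₁ hj₁inj j₃ hj₃ hj₃inj
  obtain ⟨hprim₁, hprim₂, hprim₃, hfin₁, hfin₂, hfin₃, hinv₁, hinv₂, hinv₃, hN₂, hfinq, hε, hN₁D, htrivD, hfinQ, hN₃, hfinED,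
      hinvD₁, hinvD₃⟩ := hpack
  -- the curve-side Kummer conjuncts
  have hr₂ : ∀ x : ↥((W.baseChange K).geomPrimaryTorsion p),
      x ∈ (AddSubgroup.inclusion (geomTorsion_le_geomPrimaryTorsion (W.baseChange K) p)).range ↔ p • x = 0 := by
    intro x
    constructor
    · rintro ⟨y, rfl⟩
      apply Subtype.ext
      rw [AddSubgroupClass.coe_nsmul, AddSubgroup.coe_inclusion, ZeroMemClass.coe_zero, ← natCast_zsmul]
      exact (Submodule.mem_torsionBy_iff _ _).mp y.2
    · intro hx
      have hx' : (p : ℤ) • (x : geomPoints (W.baseChange K)) = 0 := by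
        rw [natCast_zsmul, ← AddSubgroupClass.coe_nsmul, hx, ZeroMemClass.coe_zero]
      exact ⟨⟨(x : geomPoints (W.baseChange K)), (Submodule.mem_torsionBy_iff _ _).mpr hx'⟩, Subtype.ext rfl⟩
  have hd₂ : ∀ x : ↥((W.baseChange K).geomPrimaryTorsion p), ∃ x' : ↥((W.baseChange K).geomPrimaryTorsion p),
      p • x' = x :=
    (W.baseChange K).exists_nsmul_eq_geomPrimaryTorsion p (W.baseChange K).zsmul_geomPoints_surjective_holds
  have hθsub : ∀ σ : absoluteGaloisGroup K, θsub σ ^ (p - 1) = 1 := fun σ ↦ (hpair.pow_sub_one σ).1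
  have hθquot : ∀ σ : absoluteGaloisGroup K, θquot σ ^ (p - 1) = 1 := fun σ ↦ (hpair.pow_sub_one σ).2
  -- H² (x1-p1-w4 g5, reduction-free; `cd_p ≤ 2` by name)
  have hH2' := IndexInputsH2.natCard_H2_conjunct_ofTateTC hCD2 h41 h42 h5A h32 W hp hK hH hv hvbar hne κ hκ γ hpair Sf hSf hSsub hSquot Φ
    j₁ j₃ hj₁ hj₃ hj₁inj hj₃inj hr₁ hr₃
  exact ⟨c, fun i : ℕ ↦ γ ^ i, Φ, j₁, j₃, hj₁, hj₃, hτ, hdist, hreps _, hreps _, hreps _, hj₁inj, hj₃inj, hr₁, hr₃, hr₂, hd₂,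
    fun w hw hpw ↦ IndexInputsH0.injective_resH1Hom_inertiaIn_incl W κ.kerSubgroup Sf hSf Φ w hw hpw,
    fun w _ _ ↦ IndexInputsH0.injective_resH1Hom_inertiaIn_of_charModule κ.kerSubgroup θsub hθsub j₁ hj₁ hj₁inj hr₁ w,
    fun w hw hpw ↦ IndexInputsH0.injective_resH1Hom_inertiaIn_inclusion W κ.kerSubgroup Sf hSf w hw hpw,
    fun w _ _ ↦ IndexInputsH0.injective_resH1Hom_inertiaIn_of_charModule κ.kerSubgroup θquot hθquot j₃ hj₃ hj₃inj hr₃ w,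
    hsur₁, hsur₂, hsur₃, hprim₁, hprim₂, hprim₃, hfin₁, hfin₂, hfin₃,
    hinv₁, hinv₂, hinv₃, hN₂, hfinq, hε, hN₁D, htrivD, hfinQ, hN₃, hinvD₁, hinvD₃, hH2'⟩

end Summit.BirchSwinnertonDyer.BirchSwinnertonDyer.Theorems.SchneiderFreeAdditiveX3.AnomalousTwistIndexInputsOfPT

end
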